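import Summits.BirchSwinnertonDyer.BirchSwinnertonDyer.Theorems.AdditiveKolyvaginRoadLevelSystemsOfSeedCruxFree
import Summits.BirchSwinnertonDyer.BirchSwinnertonDyer.Theorems.AdditiveKolyvaginRoadLevelKolyvaginSystemsAdditiveStubLevelClimbOfIgnition
import Summits.BirchSwinnertonDyer.BirchSwinnertonDyer.Theorems.AdditiveKolyvaginRoadLevelRealisation
import Summits.BirchSwinnertonDyer.BirchSwinnertonDyer.Theorems.AdditiveKolyvaginRoadBottomTransferKrizLiDepletion
import Summits.BirchSwinnertonDyer.BirchSwinnertonDyer.Theorems.AdditiveKolyvaginRoadLevelKolyvaginSystemsAdditiveRankOneVanishing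
import HarnessLib

/-! # LevelKolyvaginSystemsAdditive — line `additive-fibre-ignition` (crux-plan S1, 2026-08-28; skeleton v5 = v4 + VANISH plugged)

Crux item stmt-BirchSwinnertonDyer-21396 (route `AdditiveKolyvaginRoad`, KS′):
`Summit.BirchSwinnertonDyer.BirchSwinnertonDyer.Theses.AdditiveKolyvaginRoad.LevelKolyvaginSystemsAdditive`.
Idea `additive-fibre-ignition` ⊕ the K1 module (director-bsd g12 merge; TRIAGE-r1-1 §2/§4, TRIAGE-r1-2 §2-C).

CUT (by MECHANISM, not by local type — the dead line `birth` cut by type and both halves needed the unprinted rank-0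
anchor (γ)/(A5) at `p² ∣ N`; this line never asks for it):
* the SOCKET is the landed `AdditiveKoly.levelKolyvaginSystemsAdditive_of_seed_free` (p594553): PUB → DUAL → ⟨geometric
  bipartite datum + ONE seed at a level of total canonical rank ≤ 1⟩ → KS′ — every E-side binder ((R′), `selmer_bottom`,
  connectivity, rigidity = Howard Lemma 2.3.3/2.3.4) is already discharged inside it;
* `stub_geometricBipartiteDatum` (K1, OPEN, shared by every line on this crux): W. Zhang's classes `c(∏m, ∏n) ∈ H¹(K, E[p])`
  at the `p²M·∏n` levels with the Kolyvagin-system axioms at every non-empty even level, the sign at EVERY even level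
  (`∅` included: Gross Prop. 5.4 (2)), and the two Bertolini–Darmon reciprocity laws TWO-SIDED with explicit odd-level
  values `lam` — the socket's datum minus its seed; NO `baseCase`, NO anchor;
* `stub_additiveFibreIgnition` ((γ′), OPEN — the SEED SOCKET of the line; v3: typed in the WEAK form the composition consumes):
  at SOME Kolyvagin conductor `∏ m₀` the Kolyvagin class mod `p` of every Kolyvagin–Heegner datum of that conductor is NON-ZERO;
  the idea's lever is the ENGINE for it — by the additive-fibre identity (★) the class is even DETECTED at a place above `p` when its
  additive-fibre coordinate `S_{m₀} = u(loc_𝔭 c(m₀))` is non-zero (`∉ torsionLocalKer_𝔭 ⟹ ≠ 0` by `zero_mem`); it is a seed at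
  conductor `m₀`, level `∅` (other engines plug into the same socket: at `m₀ = ∅` on the avatar (γ)-locus the tree theorem
  `AdditiveKoly.kolyvaginClass_one_ne_zero_of_thm116_of_lossless` gives it modulo Kriz–Li Thm 1.16 by name + a log certificate);
* the m-DIRECTION TWIN that carries this seed to the socket's seed (conductor `∅`, a non-empty even level of rank ≤ 1),
  split into its two printed mechanisms, both E-side over the abstract datum granted DUAL: `stub_levelClimbOfIgnition`
  (W. Zhang Thm 9.1's walk run upward through laws (A)/(B) with Čebotarev and the parity ∕ lowering lemmas) and
  `stub_kolyvaginRankOneVanishing` (Kolyvagin's triangulation, W. Zhang Lemma 8.4 (1): `dim Sel^{ε_ν} = ν + 1`, so total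
  rank ≤ 1 forces vanishing order `ν = 0`, i.e. `c(1, n₀) ≠ 0`);
* `stub_publishedInputs` ∕ `stub_publishedDualityInputs`: the route's displayed PUB ∕ DUAL conjunctions BY NAME (support
  items stmt-…-20137 ∕ the DUAL decl; provable-now bookkeeping, endorsed as by-name stubs by TRIAGE-r1-1 g3 §2).
COMPOSITION `LevelKolyvaginSystemsAdditive_of` (no sorry): K1 gives the datum; ignition + `realisation` give
`κ₀ m₀ ∅ ≠ 0`; the climb gives `n₀` non-empty even of rank ≤ 1 with some `κ₀ m n₀ ≠ 0`; the
vanishing lemma gives `κ₀ ∅ n₀ ≠ 0`; the socket closes KS′ BY NAME. (`kolyvaginPrimitiveAdditive_of_published_of_levelSystems`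
then gives KPA′ = crux r2 by name as well.) BSD is NOT proved by any of this: two stubs are OPEN (K1: level raising ∕
two-sided reciprocity at `p² ∣ N`, multiplicity one off the EGS-generic locus — DEAD-LINES D1; ignition: a HORIZONTAL mod-`p`
non-vanishing with no printed equidistribution engine), two are E-side theorems to be written, two are by-name inputs.

STATE v2 (width seats akr-p2x-w3 g4 / akr-p2x-w2 g3, 2026-08-28): the two E-side stubs are THEOREMS — CLIMB =
`AdditiveKoly.stub_levelClimbOfIgnition` (p602368, `Theorems/AdditiveKolyvaginRoadLevelKolyvaginSystemsAdditiveStubLevelClimbOfIgnition.lean`;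
its `sorry` is GONE below) and VANISH = `AdditiveKoly.kolyvaginRankOneVanishing` (W. Zhang Lemma 8.4 (1) at one level through
`ZhangTriangulation.triangulation_at_finite` and the local–global package from DUAL.2: part 1 p602679 ✓
`Theorems/…RankOneVanishingEngine.lean`, part 2 p604311 `Theorems/…RankOneVanishing.lean` in the gate — its `sorry` below carries
the one-line replacement). After that FOUR `sorry`s remain: PUB, DUAL (by name) and the two OPEN stubs K1, IGNITION; the
composition is unchanged.

STATE v3 (crux-plan S1 gen 2, 2026-08-28T05:3xZ): (i) the LEAD cruxlead-21396 g0 PICKED `epsilon_matched_retyping` (PICKED.md,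
05:1xZ; preference epsilon > THIS LINE > bdp_rebase) and registered ITS skeleton v2 on the item at 05:10:43Z — this v3 is therefore
CRUX-WRITTEN and `lean check`ed but deliberately NOT re-registered (`ledger skeleton check` replaces the item's single `skeleton`
record and would bounce the live lead's `--supports` proposals, ESIDE-LEDGER «Registry race»); the lead re-registers it with ONE
command at a switch: `ledger skeleton check $(ledger crux dir stmt-BirchSwinnertonDyer-21396)/Lines/additive_fibre_ignition.lean
--crux stmt-BirchSwinnertonDyer-21396`. (ii) IGNITION is re-typed in the WEAK form `∃ m₀, ∀ d, d.kolyvaginClass _ 1 ≠ 0` — exactly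
what `LevelKolyvaginSystemsAdditive_of` consumes through `realisation` (`∀ d` because K1's `κ₀ m₀ ∅` is realised by SOME datum the
seed cannot choose); the 𝔭-DETECTION form of v1/v2 is the additive-fibre engine's output and implies it by `zero_mem`. (iii) VANISH:
p604311 still PENDING in the gate at v3 time (farm build queue); its `sorry` keeps the one-line replacement. (iv) ROUTE-LEVEL READING,
kernel-checked below as `kolyvaginPrimitiveAdditive_of_stubs`: the stubs PUB + IGNITION ALONE prove the route's crux r2
`KolyvaginPrimitiveAdditive` (KPA′, item stmt-BirchSwinnertonDyer-21400) BY NAME (realisation data exist unconditionally,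
`nonempty_kolyvaginHeegnerData_finsetProd`; `Method2.kolSupp_finsetProd`) — so inside THIS route K1 ∕ CLIMB ∕ VANISH serve only KS′
itself: once any engine fires the seed, `closes` can be fed at r2 without KS′ (TRIAGE-r1-2 §2-C «a 21400-line in a 21396 coat», now
kernel-checked in this file; re-homing is the pen's ∕ director's call, not this seat's). (v) NICHE: the avatar locus of the picked line is a
sub-row of (5, II*) ∪ (5, II) (TRIAGE-r1-1 g5/g6: 585 + 25 EC-avatar pairs at p = 5 in Cremona N < 5·10⁵, none at p ≥ 7); OFF it the
picked line's `stub_offAvatarLocus` is KS′ verbatim, and K1 + IGNITION (this file) ∕ `bdp_rebase` are the only decompositions —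
the additive-fibre engine is type- and slope-blind (it also covers the potentially multiplicative third, 69 465 ∕ 184 923 ♯ frames of
FW-LOCUS-CENSUS, which FW-(a) and the BDP rebase exclude).

STATE v4 (crux-plan S1 gen 3, 2026-08-28T06:xxZ): (i) REGISTRY unchanged by design — the item's single `skeleton` slot holds the LEAD's
`epsilon_matched_retyping` v4 (sha16 17b1a085585a3b19, 05:48:18Z, 6 stubs: `stub_offAvatarLocus` (RESIDUAL = KS′ verbatim OFF the
(γ)-avatar locus), `stub_publishedInputsEpsilon`, `stub_kummerLineAtP`, `stub_lenderBipartiteDatum` (= K1 for the p-GOOD lender `E₀`,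
in print), `stub_lenderCoreConnected`, `stub_lenderSeed`); the lead read this line as fallback #1 and is not switching (STATUS 05:53:44Z).
This file stays CRUX-WRITTEN, checked, NOT re-registered (one command for the lead, above). (ii) DIVISION OF LABOUR made explicit: ON the
(γ)-avatar locus the lead's line closes KS′ modulo hKL + certificate + its stubs; THIS line is the plan for the lead's residual — OFF the
locus `stub_offAvatarLocus` IS the crux, and K1 + IGNITION (+ PUB ∕ DUAL, VANISH) is its only decomposition on file besides `bdp_rebase`
(whose S3 is THIS K1 VERBATIM — one proof closes both; K1's text is therefore frozen). (iii) NEW kernel-checked RUNG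
`additiveFibreIgnition_onGammaLocus` (0 sorry): on the (γ)-avatar locus the conclusion of `stub_additiveFibreIgnition` HOLDS with `m₀ = ∅`,
modulo Kriz–Li Thm. 1.16 BY NAME — the tree theorems `AdditiveKoly.kolyvaginClass_one_ne_zero_of_thm116_of_lossless` (p605382) +
`AdditiveKoly.hdep_of_sign` (p605510); i.e. engine (E-γ) of the card is a theorem and the seed socket is fed on the picked locus by the
picked line's own input (a rung, not a stub: the composition does not consume it; KS′ is NOT known on that locus, so the rung lies outside
the crux's proved regime). (iv) VANISH: p604311 is NOT rejected but DEFERRED by the hub (farm snapshot `remote:incoherent` for module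
`…RankOneVanishingEngine`, attempt 17 at 06:05Z, backoff ≈ 9 min) — its `sorry` below still carries the import + one-line replacement;
nothing in the statement changed. BSD is NOT proved by any of this; KS′ and KPA′ stay OPEN.

STATE v5 (width seat akr-p2x-w2 g5, 2026-08-28T08:4xZ; after the LEAD's outcome `promote-stub S1` on line `epsilon_matched_retyping`,
skeleton of record v8 1f29e42c069cc6eb, result p616119): VANISH p604311 is ACCEPTED (commit 6838b8825923) and is PLUGGED here —
`stub_kolyvaginRankOneVanishing := AdditiveKoly.kolyvaginRankOneVanishing`, new import `…LevelKolyvaginSystemsAdditiveRankOneVanishing`;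
`lean check` rc 0, sorries 4 = PUB, DUAL (by name) + the two OPEN stubs K1 `stub_geometricBipartiteDatum`, IGNITION `stub_additiveFibreIgnition`;
audit: CLIMB and VANISH `closed: true`. No stub TEXT changed (K1 stays byte-shared with `bdp_rebase` S3). Still NOT re-registered: the item's
skeleton slot holds the lead's v8 of record; re-registration is the next lead's one command (above). The landed partial of the picked line,
`AdditiveKoly.levelKolyvaginSystemsAdditive_onGammaAvatarLocus` (p616119, KS′ on the (γ)-avatar locus GRANTED 7 refereed facts), is the
natural import for a re-line of the COMPLEMENT: off that locus K1 + IGNITION is this file's decomposition. BSD is NOT proved by any of this;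
KS′ and KPA′ stay OPEN. -/

set_option linter.dupNamespace false
set_option autoImplicit false

noncomputable section

open scoped Classical

open WeierstrassCurve NumberField IsDedekindDomain
  Literature.NumberTheory.EllipticCurves Literature.NumberTheory.EllipticCurves.ModularForms
  Literature.NumberTheory.EllipticCurves.Rank1Residual Literature.NumberTheory.GaloisRepresentations Module
  Summit.BirchSwinnertonDyer.Rank1Residual.X11b.Three.Koly
  Summit.BirchSwinnertonDyer.BirchSwinnertonDyer.Theses.AdditiveKolyvaginRoad
  Summit.BirchSwinnertonDyer.BirchSwinnertonDyer.Theorems.AdditiveKoly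

namespace Summit.BirchSwinnertonDyer.BirchSwinnertonDyer.Cruxes.LevelKolyvaginSystemsAdditive.AdditiveFibreIgnition

/-- stub PUB (by name): the route's displayed published inputs `PublishedInputsAdditiveKoly` (support item, split into
provable-now named facts; never counted as progress). -/
theorem stub_publishedInputs : PublishedInputsAdditiveKoly := by
  sorry

/-- stub DUAL (by name): the route's displayed duality inputs `PublishedDualityInputsAdditiveKoly` (Cassels–Tate level
inputs and Poitou–Tate duality for Selmer structures over number fields; named facts). -/
theorem stub_publishedDualityInputs : PublishedDualityInputsAdditiveKoly := by
  sorry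

/-- stub K1 — THE GEOMETRIC BIPARTITE DATUM (OPEN; the crux's core shared by every line; hardest stub). At a ♯ frame with
`p ≥ 5` additive, for the Kolyvagin classes mod `p` of EVERY Kolyvagin conductor `∏ m` (row `realisation`): classes
`κ₀ m n ∈ H¹(K, E[p])` at every finite set `n` of admissible primes and values `lam m n ∈ 𝔽_p`, with — at every
non-empty even level — E's Kummer condition off `m ∪ n`, the TORIC condition on `n`, the TRANSVERSE condition on `m`,
the relation (8.1); the sign under complex conjugation at EVERY even level (`∅` included); and the reciprocity laws
(A)/(B) TWO-SIDED. (= the hypothesis of `levelKolyvaginSystemsAdditive_of_seed_free` minus its seed, sign row un-guarded.)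
Printed for `p ∤ N` (W. Zhang 2014 §3–§4, (3.30), Thm 4.3; Bertolini–Darmon 2005 Thm 4.1/4.2; Gross 1991 Prop. 5.4 (2),
6.2); at `p² ∣ N` the level-raising-with-type and the multiplicity-one input behind the two-sided laws are NOT in print
(DEAD-LINES D1–D3) — why it might fail: multiplicity one on the `𝔪`-part at level `p²M∏n` fails off the EGS-generic locus
((5, II*) census), so the values `lam` may need a covector carrier there. -/
theorem stub_geometricBipartiteDatum :
    PublishedInputsAdditiveKoly → PublishedDualityInputsAdditiveKoly →
    ∀ (W : WeierstrassCurve ℚ) [W.IsElliptic] [W.IsGloballyMinimal] [NeZero (W.conductorNorm ℤ)]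
      (p : ℕ) [Fact p.Prime] (K : Type) [Field K] [NumberField K]
      (Dt : ModularParametrizationData W (W.conductorNorm ℤ)) (β : ℤ) (ι : K →+* ℂ),
      5 ≤ p → Addv W p → W.HasSurjectiveModNGaloisRep p →
      (∀ (ℓ : ℕ) [Fact ℓ.Prime], W.HasMultiplicativeReductionAtPrime ℓ →
        ¬ p ∣ padicValInt ℓ W.minimalDiscriminantInt) →
      (∃ (ℓ₁ ℓ₂ : ℕ) (_ : Fact ℓ₁.Prime) (_ : Fact ℓ₂.Prime), ℓ₁ ≠ ℓ₂ ∧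
        W.HasMultiplicativeReductionAtPrime ℓ₁ ∧ W.HasMultiplicativeReductionAtPrime ℓ₂) →
      ¬ p ∣ W.tamagawaProduct → W.analyticRank = 1 →
      IsImaginaryQuadratic K → Odd (NumberField.discr K) → NumberField.discr K < -4 →
      SatisfiesHeegnerHypothesis (W.conductorNorm ℤ) K →
      (W.quadraticTwist (NumberField.discr K : ℚ)).entireLFunction 1 ≠ 0 →
      (4 * (W.conductorNorm ℤ : ℤ)) ∣ β ^ 2 - NumberField.discr K → ¬ (p : ℤ) ∣ Dt.c →
      ∀ (c : K ≃ₐ[ℚ] K), c ≠ 1 → ∀ [Module (ZMod p) (Vp W K p)],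
      ∃ (ε₀ : Finset (AdmQ W K p) → Bool)
        (κ₀ : Finset {ℓ // Zhang2014.IsKolyvaginPrime (W.conductorNorm ℤ) W K p ℓ} → Finset (AdmQ W K p) → Vp W K p)
        (lam : Finset {ℓ // Zhang2014.IsKolyvaginPrime (W.conductorNorm ℤ) W K p ℓ} → Finset (AdmQ W K p) → ZMod p),
        -- realisation at level `∅`: the classes ARE the frame's Kolyvagin classes mod `p`
        (∀ m : Finset {ℓ // Zhang2014.IsKolyvaginPrime (W.conductorNorm ℤ) W K p ℓ},
          ∃ d : KolyvaginHeegnerData Dt β ι (∏ ℓ ∈ m, (ℓ : ℕ)), κ₀ m ∅ = d.kolyvaginClass (Fact.out : p.Prime) 1) ∧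
        -- sign at EVERY even level, `∅` included (Gross Prop. 5.4 (2) at level `∅`; the socket's row is the `n.Nonempty` restriction)
        (∀ n : Finset (AdmQ W K p), Even n.card →
          ∀ m : Finset {ℓ // Zhang2014.IsKolyvaginPrime (W.conductorNorm ℤ) W K p ℓ},
          conjAct W c ((p ^ 1 : ℕ) : ℤ) (κ₀ m n) = sgnP (ε₀ n ^^ Nat.bodd m.card) • κ₀ m n) ∧
        -- selmer_off
        (∀ n : Finset (AdmQ W K p), n.Nonempty → Even n.card →
          ∀ (m : Finset {ℓ // Zhang2014.IsKolyvaginPrime (W.conductorNorm ℤ) W K p ℓ}) (v : HeightOneSpectrum (𝓞 K)),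
          (∀ ℓ ∈ m, ((ℓ : ℕ) : 𝓞 K) ∉ v.asIdeal) → (∀ q ∈ n, ((q : ℕ) : 𝓞 K) ∉ v.asIdeal) →
          κ₀ m n ∈ selmerLocalKer (W.baseChange K) (v.adicCompletion K) ((p ^ 1 : ℕ) : ℤ)) ∧
        -- selmer_inf
        (∀ n : Finset (AdmQ W K p), n.Nonempty → Even n.card →
          ∀ (m : Finset {ℓ // Zhang2014.IsKolyvaginPrime (W.conductorNorm ℤ) W K p ℓ}) (w : InfinitePlace K),
          κ₀ m n ∈ selmerLocalKer (W.baseChange K) w.Completion ((p ^ 1 : ℕ) : ℤ)) ∧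
        -- toric_on
        (∀ n : Finset (AdmQ W K p), n.Nonempty → Even n.card →
          ∀ m : Finset {ℓ // Zhang2014.IsKolyvaginPrime (W.conductorNorm ℤ) W K p ℓ}, ∀ q ∈ n,
          ∀ v : HeightOneSpectrum (𝓞 K), ((q : ℕ) : 𝓞 K) ∈ v.asIdeal →
          κ₀ m n ∈ toricLocalKer (W.baseChange K) (v.adicCompletion K) ((p ^ 1 : ℕ) : ℤ)) ∧
        -- transverse_on
        (∀ n : Finset (AdmQ W K p), n.Nonempty → Even n.card →
          ∀ m : Finset {ℓ // Zhang2014.IsKolyvaginPrime (W.conductorNorm ℤ) W K p ℓ}, ∀ ℓ ∈ m,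
          ∀ v : HeightOneSpectrum (𝓞 K), ((ℓ : ℕ) : 𝓞 K) ∈ v.asIdeal → κ₀ m n ∈ transverseLocalKerP W K p ι ℓ v) ∧
        -- relation (8.1)
        (∀ n : Finset (AdmQ W K p), n.Nonempty → Even n.card →
          ∀ (m : Finset {ℓ // Zhang2014.IsKolyvaginPrime (W.conductorNorm ℤ) W K p ℓ})
            (ℓ : {ℓ // Zhang2014.IsKolyvaginPrime (W.conductorNorm ℤ) W K p ℓ}), ℓ ∉ m →
          ∀ v : HeightOneSpectrum (𝓞 K), ((ℓ : ℕ) : 𝓞 K) ∈ v.asIdeal →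
          (κ₀ (insert ℓ m) n ∈ (W.baseChange K).torsionLocalKer (v.adicCompletion K) ((p ^ 1 : ℕ) : ℤ) ↔
            κ₀ m n ∈ (W.baseChange K).torsionLocalKer (v.adicCompletion K) ((p ^ 1 : ℕ) : ℤ))) ∧
        -- law (A), TWO-SIDED: the value one level up is a unit iff the class is detected at the NEW prime
        (∀ (n : Finset (AdmQ W K p)) (q : AdmQ W K p), Even n.card → q ∉ n →
          ∀ m : Finset {ℓ // Zhang2014.IsKolyvaginPrime (W.conductorNorm ℤ) W K p ℓ},
          lam m (insert q n) ≠ 0 ↔ ∃ v : HeightOneSpectrum (𝓞 K), ((q : ℕ) : 𝓞 K) ∈ v.asIdeal ∧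
            κ₀ m n ∉ (W.baseChange K).torsionLocalKer (v.adicCompletion K) ((p ^ 1 : ℕ) : ℤ)) ∧
        -- law (B), TWO-SIDED: the class is detected at a LEVEL prime iff the value one level down is a unit
        (∀ (n : Finset (AdmQ W K p)) (q : AdmQ W K p), Odd n.card → q ∉ n →
          ∀ m : Finset {ℓ // Zhang2014.IsKolyvaginPrime (W.conductorNorm ℤ) W K p ℓ},
          (∃ v : HeightOneSpectrum (𝓞 K), ((q : ℕ) : 𝓞 K) ∈ v.asIdeal ∧
            κ₀ m (insert q n) ∉ (W.baseChange K).torsionLocalKer (v.adicCompletion K) ((p ^ 1 : ℕ) : ℤ)) ↔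
            lam m n ≠ 0) := by
  sorry

/-- stub IGNITION (γ′) — THE SEED (OPEN; v3 WEAK form = what the composition consumes): at a ♯ frame there is a Kolyvagin
conductor `∏ m₀` such that the Kolyvagin class mod `p` of EVERY Kolyvagin–Heegner datum of that conductor is NON-ZERO in
`H¹(K, E[p])`. `∀ d` is the composable form (K1's `κ₀ m₀ ∅` is realised by SOME datum; two data of one conductor give classes
differing by a unit of `(ℤ/p)ˣ` — choice of `σ_ℓ`, coset representatives, embedding — so `∀ d ⟺ ∃ d`, but that unit lemma is not
in the tree and the composition must not need it). ENGINES (none is part of the stub): (E-add) the idea's lever — by the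
additive-fibre identity (★) `u ∘ loc_𝔭 ∘ c(m) = S_m(u)`, a non-zero dlog-twisted Hecke sum `S_{m₀}` of the fixed mod-`p` modular
function `u ∈ 𝔽_p(X₀(M))` at the CM points of conductor `m₀` gives 𝔭-DETECTION `c(m₀) ∉ torsionLocalKer_𝔭` (the v1/v2 typing),
hence `≠ 0` by `zero_mem`; certified per frame (325b1, p = 5, K = ℚ(√−159): `S_∅ = 0`, `S_89 = 2`); as a theorem a HORIZONTAL
(Kolyvagin-prime) mod-`p` non-vanishing with no printed equidistribution engine (Cornut–Vatsal ∕ Hida are vertical); type- and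
slope-blind. (E-γ) at `m₀ = ∅` on the avatar (γ)-locus: `AdditiveKoly.kolyvaginClass_one_ne_zero_of_thm116_of_lossless` (tree, 0
sorry) gives `∀ d : conductor 1, d.kolyvaginClass _ 1 ≠ 0` modulo Kriz–Li Thm 1.16 BY NAME + the per-frame lossless-log certificate.
(E-bdp) `bdp_rebase`'s bottom index. STRENGTH (kernel-checked below, `kolyvaginPrimitiveAdditive_of_stubs`): with PUB this stub
ALONE gives the route's crux r2 KPA′ by name — it IS Kolyvagin's conjecture mod `p` at the frame in `∀ d`-form; inside this line it is
the one seed that K1 + CLIMB + VANISH turn into the full level system KS′. -/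
theorem stub_additiveFibreIgnition :
    PublishedInputsAdditiveKoly →
    ∀ (W : WeierstrassCurve ℚ) [W.IsElliptic] [W.IsGloballyMinimal] [NeZero (W.conductorNorm ℤ)]
      (p : ℕ) [Fact p.Prime] (K : Type) [Field K] [NumberField K]
      (Dt : ModularParametrizationData W (W.conductorNorm ℤ)) (β : ℤ) (ι : K →+* ℂ),
      5 ≤ p → Addv W p → W.HasSurjectiveModNGaloisRep p →
      (∀ (ℓ : ℕ) [Fact ℓ.Prime], W.HasMultiplicativeReductionAtPrime ℓ →
        ¬ p ∣ padicValInt ℓ W.minimalDiscriminantInt) →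
      (∃ (ℓ₁ ℓ₂ : ℕ) (_ : Fact ℓ₁.Prime) (_ : Fact ℓ₂.Prime), ℓ₁ ≠ ℓ₂ ∧
        W.HasMultiplicativeReductionAtPrime ℓ₁ ∧ W.HasMultiplicativeReductionAtPrime ℓ₂) →
      ¬ p ∣ W.tamagawaProduct → W.analyticRank = 1 →
      IsImaginaryQuadratic K → Odd (NumberField.discr K) → NumberField.discr K < -4 →
      SatisfiesHeegnerHypothesis (W.conductorNorm ℤ) K →
      (W.quadraticTwist (NumberField.discr K : ℚ)).entireLFunction 1 ≠ 0 →
      (4 * (W.conductorNorm ℤ : ℤ)) ∣ β ^ 2 - NumberField.discr K → ¬ (p : ℤ) ∣ Dt.c →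
      ∃ m₀ : Finset {ℓ // Zhang2014.IsKolyvaginPrime (W.conductorNorm ℤ) W K p ℓ},
        ∀ d : KolyvaginHeegnerData Dt β ι (∏ ℓ ∈ m₀, (ℓ : ℕ)), d.kolyvaginClass (Fact.out : p.Prime) 1 ≠ 0 := by
  sorry

open Field Literature.NumberTheory.GaloisCohomology Summit.BirchSwinnertonDyer.Rank1Residual in
/-- RUNG for stub IGNITION on the (γ)-AVATAR LOCUS (v4; kernel-checked, 0 sorry; NOT a stub — `LevelKolyvaginSystemsAdditive_of`
does not consume it): at a ♯ frame carrying a `p`-GOOD NON-ANOMALOUS rational avatar `E₀ = W₀` (a `Γ_ℚ`-equivariant `E[p] ≃ E₀[p]`,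
the same radical and the same multiplicative primes, SIGN AGREEMENT `a_ℓ(E) = a_ℓ(E₀)` at the multiplicative primes of `E₀`, Heegner
hypothesis for `N₀`, `p ∤ c(Dt₀)`) together with the LOG CERTIFICATE «some Heegner point `y₀ ∈ E₀(K)` over `heegnerPointComplex Dt₀ H₀`
is not `p`-divisible in `E₀(ℚ_p)` along `ιp`» — exactly the (γ)-avatar locus of the picked line `epsilon_matched_retyping` — the
conclusion of `stub_additiveFibreIgnition` HOLDS with `m₀ = ∅`, modulo Kriz–Li Thm. 1.16 BY NAME (`hKL`): the tree theorem
`AdditiveKoly.kolyvaginClass_one_ne_zero_of_thm116_of_lossless` (p605382; `∀ d : KolyvaginHeegnerData Dt β ι 1`) with `hdep`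
discharged by `AdditiveKoly.hdep_of_sign` (p605510) and `p` split in `K` from the Heegner hypothesis (`p ∣ N_E`, additive). This
is engine (E-γ) of the line card made a theorem; OFF that locus the stub is OPEN (engine (E-add), the idea's lever). Only the frame
binders the transfer uses are bound (no `hsp`, `htwo`, `htam`, `hr`, `hodd`, `hL`, `hβ`). [cite: KrizLi2019, Thm. 1.16]
[cite: GrossLMS1991, §4 (4.4)] -/
theorem additiveFibreIgnition_onGammaLocus
    (W : WeierstrassCurve ℚ) [W.IsElliptic] [W.IsGloballyMinimal] [NeZero (W.conductorNorm ℤ)]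
    (p : ℕ) [Fact p.Prime] (K : Type) [Field K] [NumberField K]
    (Dt : ModularParametrizationData W (W.conductorNorm ℤ)) (β : ℤ) (ι : K →+* ℂ)
    (hKL : KrizLi2019.thm116_padicLogHeegner_congruence)
    (h5 : 5 ≤ p) (hadd : Addv W p) (hsurj : W.HasSurjectiveModNGaloisRep p)
    (hK : IsImaginaryQuadratic K) (hlt : NumberField.discr K < -4)
    (hH : SatisfiesHeegnerHypothesis (W.conductorNorm ℤ) K) (hcM : ¬ (p : ℤ) ∣ Dt.c)
    (W₀ : WeierstrassCurve ℚ) [W₀.IsElliptic] [W₀.IsGloballyMinimal] [NeZero (W₀.conductorNorm ℤ)]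
    (e : geomTorsion W (p : ℤ) ≃+ geomTorsion W₀ (p : ℤ))
    (he : ∀ (σ : absoluteGaloisGroup ℚ) (T : geomTorsion W (p : ℤ)), e (σ • T) = σ • e T)
    (hgood₀ : W₀.HasGoodReductionAtPrime p) (hna : ¬ (p : ℤ) ∣ W₀.frobeniusTrace p - 1)
    (hrad : ∀ q : ℕ, q.Prime → (q ∣ p * W.conductorNorm ℤ ↔ q ∣ p * W₀.conductorNorm ℤ))
    (htype : ∀ (ℓ : ℕ) [Fact ℓ.Prime], W.HasMultiplicativeReductionAtPrime ℓ ↔ W₀.HasMultiplicativeReductionAtPrime ℓ)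
    (hsign : ∀ (ℓ : ℕ) [Fact ℓ.Prime], W₀.HasMultiplicativeReductionAtPrime ℓ → W.LFunction ℓ = W₀.LFunction ℓ)
    (Dt₀ : ModularParametrizationData W₀ (W₀.conductorNorm ℤ)) (hc₀ : ¬ (p : ℤ) ∣ Dt₀.c)
    (hH₀ : SatisfiesHeegnerHypothesis (W₀.conductorNorm ℤ) K) (ιp : K →+* ℚ_[p])
    (hcert : ∃ (H₀ : HeegnerDatum (W₀.conductorNorm ℤ) (NumberField.discr K)) (y₀ : (W₀.baseChange K).toAffine.Point),
      WeierstrassCurve.Affine.Point.map ι.toRatAlgHom y₀ = heegnerPointComplex Dt₀ H₀ ∧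
        ¬ ∃ Q : (W₀.baseChange ℚ_[p]).toAffine.Point, (p : ℤ) • Q = X11b.padicPointOf W₀ p ιp y₀) :
    ∃ m₀ : Finset {ℓ // Zhang2014.IsKolyvaginPrime (W.conductorNorm ℤ) W K p ℓ},
      ∀ d : KolyvaginHeegnerData Dt β ι (∏ ℓ ∈ m₀, (ℓ : ℕ)), d.kolyvaginClass (Fact.out : p.Prime) 1 ≠ 0 := by
  -- `p` splits in `K`: `p ∣ N_E` (additive reduction) and `K` is Heegner for `N_E`
  have hsplit : ((Ideal.span {(p : ℤ)}).primesOver (𝓞 K)).ncard = 2 :=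
    hH p Fact.out ((W.dvd_conductorNorm_iff_not_hasGoodReductionAtPrime p).mpr hadd.1)
  -- the conductor-one transfer, for EVERY conductor-one datum (`∏ ℓ ∈ ∅, ℓ = 1` by `Finset.prod_empty`)
  have key : ∀ n : ℕ, n = 1 → ∀ d : KolyvaginHeegnerData Dt β ι n, d.kolyvaginClass (Fact.out : p.Prime) 1 ≠ 0 := by
    rintro n rfl d
    exact kolyvaginClass_one_ne_zero_of_thm116_of_lossless W p K Dt β ι hKL h5 hadd hsurj hK hlt hH hcM W₀ e he hgood₀ hna
      (hdep_of_sign W W₀ p hrad htype hsign) Dt₀ hc₀ hH₀ hsplit ιp hcert d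
  exact ⟨∅, key _ Finset.prod_empty⟩

/-- stub CLIMB (m-direction twin, part 1; E-side, to be written): over the abstract datum, a non-zero class at level `∅`
of any conductor propagates UP the admissible levels to a NON-EMPTY EVEN level of total canonical rank ≤ 1 carrying a
non-zero class of some conductor. Mechanism (W. Zhang 2014 Thm 9.1's walk, pp. 240–242, run upward): Čebotarev for the
eigenclass `κ₀ m ∅` (`Cheb.exists_admissible_loc_ne_zero`, sign row at `∅`) + law (A) at `∅` + law (B) at `{q}` give a
non-zero class at `{q, q'}`; then at an even level of rank ≥ 2 the minimal-order non-zero class is a canonical Selmer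
eigenclass (relation + selmer/toric rows), an admissible `q` detecting it lowers the rank by one and makes
`lam m (n ∪ q)` a unit (law (A)), any detecting `q'` lowers again and law (B) keeps the class non-zero at `n ∪ {q, q'}`
(`selQP_lower_of_detected`, `RigidityDichotomy.total_insert_of_detected`, (R′) `selQP_raise_free` from DUAL.2). -/
theorem stub_levelClimbOfIgnition :
    PublishedInputsAdditiveKoly → PublishedDualityInputsAdditiveKoly →
    ∀ (W : WeierstrassCurve ℚ) [W.IsElliptic] [W.IsGloballyMinimal] [NeZero (W.conductorNorm ℤ)]
      (p : ℕ) [Fact p.Prime] (K : Type) [Field K] [NumberField K]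
      (Dt : ModularParametrizationData W (W.conductorNorm ℤ)) (β : ℤ) (ι : K →+* ℂ),
      5 ≤ p → Addv W p → W.HasSurjectiveModNGaloisRep p →
      (∀ (ℓ : ℕ) [Fact ℓ.Prime], W.HasMultiplicativeReductionAtPrime ℓ →
        ¬ p ∣ padicValInt ℓ W.minimalDiscriminantInt) →
      (∃ (ℓ₁ ℓ₂ : ℕ) (_ : Fact ℓ₁.Prime) (_ : Fact ℓ₂.Prime), ℓ₁ ≠ ℓ₂ ∧
        W.HasMultiplicativeReductionAtPrime ℓ₁ ∧ W.HasMultiplicativeReductionAtPrime ℓ₂) →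
      ¬ p ∣ W.tamagawaProduct → W.analyticRank = 1 →
      IsImaginaryQuadratic K → Odd (NumberField.discr K) → NumberField.discr K < -4 →
      SatisfiesHeegnerHypothesis (W.conductorNorm ℤ) K →
      (W.quadraticTwist (NumberField.discr K : ℚ)).entireLFunction 1 ≠ 0 →
      (4 * (W.conductorNorm ℤ : ℤ)) ∣ β ^ 2 - NumberField.discr K → ¬ (p : ℤ) ∣ Dt.c →
      ∀ (c : K ≃ₐ[ℚ] K), c ≠ 1 → ∀ [Module (ZMod p) (Vp W K p)],
      ∀ (ε₀ : Finset (AdmQ W K p) → Bool)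
        (κ₀ : Finset {ℓ // Zhang2014.IsKolyvaginPrime (W.conductorNorm ℤ) W K p ℓ} → Finset (AdmQ W K p) → Vp W K p)
        (lam : Finset {ℓ // Zhang2014.IsKolyvaginPrime (W.conductorNorm ℤ) W K p ℓ} → Finset (AdmQ W K p) → ZMod p),
        -- realisation at level `∅`: the classes ARE the frame's Kolyvagin classes mod `p`
        (∀ m : Finset {ℓ // Zhang2014.IsKolyvaginPrime (W.conductorNorm ℤ) W K p ℓ},
          ∃ d : KolyvaginHeegnerData Dt β ι (∏ ℓ ∈ m, (ℓ : ℕ)), κ₀ m ∅ = d.kolyvaginClass (Fact.out : p.Prime) 1) →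
        -- sign at EVERY even level, `∅` included (Gross Prop. 5.4 (2) at level `∅`; the socket's row is the `n.Nonempty` restriction)
        (∀ n : Finset (AdmQ W K p), Even n.card →
          ∀ m : Finset {ℓ // Zhang2014.IsKolyvaginPrime (W.conductorNorm ℤ) W K p ℓ},
          conjAct W c ((p ^ 1 : ℕ) : ℤ) (κ₀ m n) = sgnP (ε₀ n ^^ Nat.bodd m.card) • κ₀ m n) →
        -- selmer_off
        (∀ n : Finset (AdmQ W K p), n.Nonempty → Even n.card →
          ∀ (m : Finset {ℓ // Zhang2014.IsKolyvaginPrime (W.conductorNorm ℤ) W K p ℓ}) (v : HeightOneSpectrum (𝓞 K)),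
          (∀ ℓ ∈ m, ((ℓ : ℕ) : 𝓞 K) ∉ v.asIdeal) → (∀ q ∈ n, ((q : ℕ) : 𝓞 K) ∉ v.asIdeal) →
          κ₀ m n ∈ selmerLocalKer (W.baseChange K) (v.adicCompletion K) ((p ^ 1 : ℕ) : ℤ)) →
        -- selmer_inf
        (∀ n : Finset (AdmQ W K p), n.Nonempty → Even n.card →
          ∀ (m : Finset {ℓ // Zhang2014.IsKolyvaginPrime (W.conductorNorm ℤ) W K p ℓ}) (w : InfinitePlace K),
          κ₀ m n ∈ selmerLocalKer (W.baseChange K) w.Completion ((p ^ 1 : ℕ) : ℤ)) →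
        -- toric_on
        (∀ n : Finset (AdmQ W K p), n.Nonempty → Even n.card →
          ∀ m : Finset {ℓ // Zhang2014.IsKolyvaginPrime (W.conductorNorm ℤ) W K p ℓ}, ∀ q ∈ n,
          ∀ v : HeightOneSpectrum (𝓞 K), ((q : ℕ) : 𝓞 K) ∈ v.asIdeal →
          κ₀ m n ∈ toricLocalKer (W.baseChange K) (v.adicCompletion K) ((p ^ 1 : ℕ) : ℤ)) →
        -- transverse_on
        (∀ n : Finset (AdmQ W K p), n.Nonempty → Even n.card →
          ∀ m : Finset {ℓ // Zhang2014.IsKolyvaginPrime (W.conductorNorm ℤ) W K p ℓ}, ∀ ℓ ∈ m,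
          ∀ v : HeightOneSpectrum (𝓞 K), ((ℓ : ℕ) : 𝓞 K) ∈ v.asIdeal → κ₀ m n ∈ transverseLocalKerP W K p ι ℓ v) →
        -- relation (8.1)
        (∀ n : Finset (AdmQ W K p), n.Nonempty → Even n.card →
          ∀ (m : Finset {ℓ // Zhang2014.IsKolyvaginPrime (W.conductorNorm ℤ) W K p ℓ})
            (ℓ : {ℓ // Zhang2014.IsKolyvaginPrime (W.conductorNorm ℤ) W K p ℓ}), ℓ ∉ m →
          ∀ v : HeightOneSpectrum (𝓞 K), ((ℓ : ℕ) : 𝓞 K) ∈ v.asIdeal →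
          (κ₀ (insert ℓ m) n ∈ (W.baseChange K).torsionLocalKer (v.adicCompletion K) ((p ^ 1 : ℕ) : ℤ) ↔
            κ₀ m n ∈ (W.baseChange K).torsionLocalKer (v.adicCompletion K) ((p ^ 1 : ℕ) : ℤ))) →
        -- law (A), TWO-SIDED: the value one level up is a unit iff the class is detected at the NEW prime
        (∀ (n : Finset (AdmQ W K p)) (q : AdmQ W K p), Even n.card → q ∉ n →
          ∀ m : Finset {ℓ // Zhang2014.IsKolyvaginPrime (W.conductorNorm ℤ) W K p ℓ},
          lam m (insert q n) ≠ 0 ↔ ∃ v : HeightOneSpectrum (𝓞 K), ((q : ℕ) : 𝓞 K) ∈ v.asIdeal ∧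
            κ₀ m n ∉ (W.baseChange K).torsionLocalKer (v.adicCompletion K) ((p ^ 1 : ℕ) : ℤ)) →
        -- law (B), TWO-SIDED: the class is detected at a LEVEL prime iff the value one level down is a unit
        (∀ (n : Finset (AdmQ W K p)) (q : AdmQ W K p), Odd n.card → q ∉ n →
          ∀ m : Finset {ℓ // Zhang2014.IsKolyvaginPrime (W.conductorNorm ℤ) W K p ℓ},
          (∃ v : HeightOneSpectrum (𝓞 K), ((q : ℕ) : 𝓞 K) ∈ v.asIdeal ∧
            κ₀ m (insert q n) ∉ (W.baseChange K).torsionLocalKer (v.adicCompletion K) ((p ^ 1 : ℕ) : ℤ)) ↔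
            lam m n ≠ 0) →
        -- a non-zero class at level `∅`, ANY Kolyvagin conductor (the ignition, or `c(1) ≠ 0` itself)
        (∃ m₀ : Finset {ℓ // Zhang2014.IsKolyvaginPrime (W.conductorNorm ℤ) W K p ℓ}, κ₀ m₀ ∅ ≠ 0) →
        ∃ n₀ : Finset (AdmQ W K p), n₀.Nonempty ∧ Even n₀.card ∧
          finrank (ZMod p) (SelQP W K p c n₀ true) + finrank (ZMod p) (SelQP W K p c n₀ false) ≤ 1 ∧
          ∃ m : Finset {ℓ // Zhang2014.IsKolyvaginPrime (W.conductorNorm ℤ) W K p ℓ}, κ₀ m n₀ ≠ 0 :=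
  _root_.Summit.BirchSwinnertonDyer.BirchSwinnertonDyer.Theorems.AdditiveKoly.stub_levelClimbOfIgnition

/-- stub VANISHING-ORDER ZERO AT RANK ONE (m-direction twin, part 2; E-side, to be written): over the abstract datum at a
non-empty even level `n₀` of total canonical rank ≤ 1, if some `κ₀ m n₀ ≠ 0` then already `κ₀ ∅ n₀ ≠ 0`. Mechanism =
Kolyvagin's triangulation (W. Zhang 2014 Lemma 8.4 (1), pp. 236–238: `dim Sel^{ε_ν} = ν + 1` for the vanishing order `ν`
of the level-`n₀` system, whence `ν + 1 ≤ 1`): minimal-order class is Selmer (relation + local rows), auxiliary class of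
Lemma 8.2 (dimension count = Poitou–Tate, DUAL.2), Čebotarev for two eigenclasses at a Kolyvagin prime (Lemma 8.1;
tree `chebTwo_of_mcCallum_P`, `exists_zhangKolyvaginPrime_notMem_of_eigenP`), sum of local Tate pairings = 0 (DUAL.2;
the Kummer condition at the additive `v ∣ p` is self-annihilating, `annRight_kummer_eq_of_odd`). [23, 28] = Kolyvagin,
McCallum in Zhang's words: "can be proved with the techniques, though not stated explicitly". -/
theorem stub_kolyvaginRankOneVanishing :
    PublishedInputsAdditiveKoly → PublishedDualityInputsAdditiveKoly →
    ∀ (W : WeierstrassCurve ℚ) [W.IsElliptic] [W.IsGloballyMinimal] [NeZero (W.conductorNorm ℤ)]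
      (p : ℕ) [Fact p.Prime] (K : Type) [Field K] [NumberField K]
      (Dt : ModularParametrizationData W (W.conductorNorm ℤ)) (β : ℤ) (ι : K →+* ℂ),
      5 ≤ p → Addv W p → W.HasSurjectiveModNGaloisRep p →
      (∀ (ℓ : ℕ) [Fact ℓ.Prime], W.HasMultiplicativeReductionAtPrime ℓ →
        ¬ p ∣ padicValInt ℓ W.minimalDiscriminantInt) →
      (∃ (ℓ₁ ℓ₂ : ℕ) (_ : Fact ℓ₁.Prime) (_ : Fact ℓ₂.Prime), ℓ₁ ≠ ℓ₂ ∧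
        W.HasMultiplicativeReductionAtPrime ℓ₁ ∧ W.HasMultiplicativeReductionAtPrime ℓ₂) →
      ¬ p ∣ W.tamagawaProduct → W.analyticRank = 1 →
      IsImaginaryQuadratic K → Odd (NumberField.discr K) → NumberField.discr K < -4 →
      SatisfiesHeegnerHypothesis (W.conductorNorm ℤ) K →
      (W.quadraticTwist (NumberField.discr K : ℚ)).entireLFunction 1 ≠ 0 →
      (4 * (W.conductorNorm ℤ : ℤ)) ∣ β ^ 2 - NumberField.discr K → ¬ (p : ℤ) ∣ Dt.c →
      ∀ (c : K ≃ₐ[ℚ] K), c ≠ 1 → ∀ [Module (ZMod p) (Vp W K p)],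
      ∀ (ε₀ : Finset (AdmQ W K p) → Bool)
        (κ₀ : Finset {ℓ // Zhang2014.IsKolyvaginPrime (W.conductorNorm ℤ) W K p ℓ} → Finset (AdmQ W K p) → Vp W K p)
        (lam : Finset {ℓ // Zhang2014.IsKolyvaginPrime (W.conductorNorm ℤ) W K p ℓ} → Finset (AdmQ W K p) → ZMod p),
        -- realisation at level `∅`: the classes ARE the frame's Kolyvagin classes mod `p`
        (∀ m : Finset {ℓ // Zhang2014.IsKolyvaginPrime (W.conductorNorm ℤ) W K p ℓ},
          ∃ d : KolyvaginHeegnerData Dt β ι (∏ ℓ ∈ m, (ℓ : ℕ)), κ₀ m ∅ = d.kolyvaginClass (Fact.out : p.Prime) 1) →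
        -- sign at EVERY even level, `∅` included (Gross Prop. 5.4 (2) at level `∅`; the socket's row is the `n.Nonempty` restriction)
        (∀ n : Finset (AdmQ W K p), Even n.card →
          ∀ m : Finset {ℓ // Zhang2014.IsKolyvaginPrime (W.conductorNorm ℤ) W K p ℓ},
          conjAct W c ((p ^ 1 : ℕ) : ℤ) (κ₀ m n) = sgnP (ε₀ n ^^ Nat.bodd m.card) • κ₀ m n) →
        -- selmer_off
        (∀ n : Finset (AdmQ W K p), n.Nonempty → Even n.card →
          ∀ (m : Finset {ℓ // Zhang2014.IsKolyvaginPrime (W.conductorNorm ℤ) W K p ℓ}) (v : HeightOneSpectrum (𝓞 K)),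
          (∀ ℓ ∈ m, ((ℓ : ℕ) : 𝓞 K) ∉ v.asIdeal) → (∀ q ∈ n, ((q : ℕ) : 𝓞 K) ∉ v.asIdeal) →
          κ₀ m n ∈ selmerLocalKer (W.baseChange K) (v.adicCompletion K) ((p ^ 1 : ℕ) : ℤ)) →
        -- selmer_inf
        (∀ n : Finset (AdmQ W K p), n.Nonempty → Even n.card →
          ∀ (m : Finset {ℓ // Zhang2014.IsKolyvaginPrime (W.conductorNorm ℤ) W K p ℓ}) (w : InfinitePlace K),
          κ₀ m n ∈ selmerLocalKer (W.baseChange K) w.Completion ((p ^ 1 : ℕ) : ℤ)) →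
        -- toric_on
        (∀ n : Finset (AdmQ W K p), n.Nonempty → Even n.card →
          ∀ m : Finset {ℓ // Zhang2014.IsKolyvaginPrime (W.conductorNorm ℤ) W K p ℓ}, ∀ q ∈ n,
          ∀ v : HeightOneSpectrum (𝓞 K), ((q : ℕ) : 𝓞 K) ∈ v.asIdeal →
          κ₀ m n ∈ toricLocalKer (W.baseChange K) (v.adicCompletion K) ((p ^ 1 : ℕ) : ℤ)) →
        -- transverse_on
        (∀ n : Finset (AdmQ W K p), n.Nonempty → Even n.card →
          ∀ m : Finset {ℓ // Zhang2014.IsKolyvaginPrime (W.conductorNorm ℤ) W K p ℓ}, ∀ ℓ ∈ m,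
          ∀ v : HeightOneSpectrum (𝓞 K), ((ℓ : ℕ) : 𝓞 K) ∈ v.asIdeal → κ₀ m n ∈ transverseLocalKerP W K p ι ℓ v) →
        -- relation (8.1)
        (∀ n : Finset (AdmQ W K p), n.Nonempty → Even n.card →
          ∀ (m : Finset {ℓ // Zhang2014.IsKolyvaginPrime (W.conductorNorm ℤ) W K p ℓ})
            (ℓ : {ℓ // Zhang2014.IsKolyvaginPrime (W.conductorNorm ℤ) W K p ℓ}), ℓ ∉ m →
          ∀ v : HeightOneSpectrum (𝓞 K), ((ℓ : ℕ) : 𝓞 K) ∈ v.asIdeal →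
          (κ₀ (insert ℓ m) n ∈ (W.baseChange K).torsionLocalKer (v.adicCompletion K) ((p ^ 1 : ℕ) : ℤ) ↔
            κ₀ m n ∈ (W.baseChange K).torsionLocalKer (v.adicCompletion K) ((p ^ 1 : ℕ) : ℤ))) →
        -- law (A), TWO-SIDED: the value one level up is a unit iff the class is detected at the NEW prime
        (∀ (n : Finset (AdmQ W K p)) (q : AdmQ W K p), Even n.card → q ∉ n →
          ∀ m : Finset {ℓ // Zhang2014.IsKolyvaginPrime (W.conductorNorm ℤ) W K p ℓ},
          lam m (insert q n) ≠ 0 ↔ ∃ v : HeightOneSpectrum (𝓞 K), ((q : ℕ) : 𝓞 K) ∈ v.asIdeal ∧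
            κ₀ m n ∉ (W.baseChange K).torsionLocalKer (v.adicCompletion K) ((p ^ 1 : ℕ) : ℤ)) →
        -- law (B), TWO-SIDED: the class is detected at a LEVEL prime iff the value one level down is a unit
        (∀ (n : Finset (AdmQ W K p)) (q : AdmQ W K p), Odd n.card → q ∉ n →
          ∀ m : Finset {ℓ // Zhang2014.IsKolyvaginPrime (W.conductorNorm ℤ) W K p ℓ},
          (∃ v : HeightOneSpectrum (𝓞 K), ((q : ℕ) : 𝓞 K) ∈ v.asIdeal ∧
            κ₀ m (insert q n) ∉ (W.baseChange K).torsionLocalKer (v.adicCompletion K) ((p ^ 1 : ℕ) : ℤ)) ↔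
            lam m n ≠ 0) →
        ∀ n₀ : Finset (AdmQ W K p), n₀.Nonempty → Even n₀.card →
          finrank (ZMod p) (SelQP W K p c n₀ true) + finrank (ZMod p) (SelQP W K p c n₀ false) ≤ 1 →
          (∃ m : Finset {ℓ // Zhang2014.IsKolyvaginPrime (W.conductorNorm ℤ) W K p ℓ}, κ₀ m n₀ ≠ 0) → κ₀ ∅ n₀ ≠ 0 :=
  -- PROVED (akr-p2x-w2 g3): `AdditiveKoly.kolyvaginRankOneVanishing`, this signature VERBATIM — engine p602679 ✓
  -- (`Theorems/…RankOneVanishingEngine.lean`) + assembly p604311 ✓ ACCEPTED (`Theorems/…RankOneVanishing.lean`, commit 6838b8825923);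
  -- plugged in v5 (akr-p2x-w2 g5, 2026-08-28): the stub is now a THEOREM, no `sorry`.
  _root_.Summit.BirchSwinnertonDyer.BirchSwinnertonDyer.Theorems.AdditiveKoly.kolyvaginRankOneVanishing

/-- COMPOSITION (kernel-checked, no sorry of its own): the six stub statements imply the crux BY NAME, through the landed
socket `levelKolyvaginSystemsAdditive_of_seed_free` (p594553). -/
theorem LevelKolyvaginSystemsAdditive_of :
    PublishedInputsAdditiveKoly →
    PublishedDualityInputsAdditiveKoly →
    (PublishedInputsAdditiveKoly → PublishedDualityInputsAdditiveKoly →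
    ∀ (W : WeierstrassCurve ℚ) [W.IsElliptic] [W.IsGloballyMinimal] [NeZero (W.conductorNorm ℤ)]
      (p : ℕ) [Fact p.Prime] (K : Type) [Field K] [NumberField K]
      (Dt : ModularParametrizationData W (W.conductorNorm ℤ)) (β : ℤ) (ι : K →+* ℂ),
      5 ≤ p → Addv W p → W.HasSurjectiveModNGaloisRep p →
      (∀ (ℓ : ℕ) [Fact ℓ.Prime], W.HasMultiplicativeReductionAtPrime ℓ →
        ¬ p ∣ padicValInt ℓ W.minimalDiscriminantInt) →
      (∃ (ℓ₁ ℓ₂ : ℕ) (_ : Fact ℓ₁.Prime) (_ : Fact ℓ₂.Prime), ℓ₁ ≠ ℓ₂ ∧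
        W.HasMultiplicativeReductionAtPrime ℓ₁ ∧ W.HasMultiplicativeReductionAtPrime ℓ₂) →
      ¬ p ∣ W.tamagawaProduct → W.analyticRank = 1 →
      IsImaginaryQuadratic K → Odd (NumberField.discr K) → NumberField.discr K < -4 →
      SatisfiesHeegnerHypothesis (W.conductorNorm ℤ) K →
      (W.quadraticTwist (NumberField.discr K : ℚ)).entireLFunction 1 ≠ 0 →
      (4 * (W.conductorNorm ℤ : ℤ)) ∣ β ^ 2 - NumberField.discr K → ¬ (p : ℤ) ∣ Dt.c →
      ∀ (c : K ≃ₐ[ℚ] K), c ≠ 1 → ∀ [Module (ZMod p) (Vp W K p)],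
      ∃ (ε₀ : Finset (AdmQ W K p) → Bool)
        (κ₀ : Finset {ℓ // Zhang2014.IsKolyvaginPrime (W.conductorNorm ℤ) W K p ℓ} → Finset (AdmQ W K p) → Vp W K p)
        (lam : Finset {ℓ // Zhang2014.IsKolyvaginPrime (W.conductorNorm ℤ) W K p ℓ} → Finset (AdmQ W K p) → ZMod p),
        -- realisation at level `∅`: the classes ARE the frame's Kolyvagin classes mod `p`
        (∀ m : Finset {ℓ // Zhang2014.IsKolyvaginPrime (W.conductorNorm ℤ) W K p ℓ},
          ∃ d : KolyvaginHeegnerData Dt β ι (∏ ℓ ∈ m, (ℓ : ℕ)), κ₀ m ∅ = d.kolyvaginClass (Fact.out : p.Prime) 1) ∧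
        -- sign at EVERY even level, `∅` included (Gross Prop. 5.4 (2) at level `∅`; the socket's row is the `n.Nonempty` restriction)
        (∀ n : Finset (AdmQ W K p), Even n.card →
          ∀ m : Finset {ℓ // Zhang2014.IsKolyvaginPrime (W.conductorNorm ℤ) W K p ℓ},
          conjAct W c ((p ^ 1 : ℕ) : ℤ) (κ₀ m n) = sgnP (ε₀ n ^^ Nat.bodd m.card) • κ₀ m n) ∧
        -- selmer_off
        (∀ n : Finset (AdmQ W K p), n.Nonempty → Even n.card →
          ∀ (m : Finset {ℓ // Zhang2014.IsKolyvaginPrime (W.conductorNorm ℤ) W K p ℓ}) (v : HeightOneSpectrum (𝓞 K)),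
          (∀ ℓ ∈ m, ((ℓ : ℕ) : 𝓞 K) ∉ v.asIdeal) → (∀ q ∈ n, ((q : ℕ) : 𝓞 K) ∉ v.asIdeal) →
          κ₀ m n ∈ selmerLocalKer (W.baseChange K) (v.adicCompletion K) ((p ^ 1 : ℕ) : ℤ)) ∧
        -- selmer_inf
        (∀ n : Finset (AdmQ W K p), n.Nonempty → Even n.card →
          ∀ (m : Finset {ℓ // Zhang2014.IsKolyvaginPrime (W.conductorNorm ℤ) W K p ℓ}) (w : InfinitePlace K),
          κ₀ m n ∈ selmerLocalKer (W.baseChange K) w.Completion ((p ^ 1 : ℕ) : ℤ)) ∧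
        -- toric_on
        (∀ n : Finset (AdmQ W K p), n.Nonempty → Even n.card →
          ∀ m : Finset {ℓ // Zhang2014.IsKolyvaginPrime (W.conductorNorm ℤ) W K p ℓ}, ∀ q ∈ n,
          ∀ v : HeightOneSpectrum (𝓞 K), ((q : ℕ) : 𝓞 K) ∈ v.asIdeal →
          κ₀ m n ∈ toricLocalKer (W.baseChange K) (v.adicCompletion K) ((p ^ 1 : ℕ) : ℤ)) ∧
        -- transverse_on
        (∀ n : Finset (AdmQ W K p), n.Nonempty → Even n.card →
          ∀ m : Finset {ℓ // Zhang2014.IsKolyvaginPrime (W.conductorNorm ℤ) W K p ℓ}, ∀ ℓ ∈ m,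
          ∀ v : HeightOneSpectrum (𝓞 K), ((ℓ : ℕ) : 𝓞 K) ∈ v.asIdeal → κ₀ m n ∈ transverseLocalKerP W K p ι ℓ v) ∧
        -- relation (8.1)
        (∀ n : Finset (AdmQ W K p), n.Nonempty → Even n.card →
          ∀ (m : Finset {ℓ // Zhang2014.IsKolyvaginPrime (W.conductorNorm ℤ) W K p ℓ})
            (ℓ : {ℓ // Zhang2014.IsKolyvaginPrime (W.conductorNorm ℤ) W K p ℓ}), ℓ ∉ m →
          ∀ v : HeightOneSpectrum (𝓞 K), ((ℓ : ℕ) : 𝓞 K) ∈ v.asIdeal →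
          (κ₀ (insert ℓ m) n ∈ (W.baseChange K).torsionLocalKer (v.adicCompletion K) ((p ^ 1 : ℕ) : ℤ) ↔
            κ₀ m n ∈ (W.baseChange K).torsionLocalKer (v.adicCompletion K) ((p ^ 1 : ℕ) : ℤ))) ∧
        -- law (A), TWO-SIDED: the value one level up is a unit iff the class is detected at the NEW prime
        (∀ (n : Finset (AdmQ W K p)) (q : AdmQ W K p), Even n.card → q ∉ n →
          ∀ m : Finset {ℓ // Zhang2014.IsKolyvaginPrime (W.conductorNorm ℤ) W K p ℓ},
          lam m (insert q n) ≠ 0 ↔ ∃ v : HeightOneSpectrum (𝓞 K), ((q : ℕ) : 𝓞 K) ∈ v.asIdeal ∧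
            κ₀ m n ∉ (W.baseChange K).torsionLocalKer (v.adicCompletion K) ((p ^ 1 : ℕ) : ℤ)) ∧
        -- law (B), TWO-SIDED: the class is detected at a LEVEL prime iff the value one level down is a unit
        (∀ (n : Finset (AdmQ W K p)) (q : AdmQ W K p), Odd n.card → q ∉ n →
          ∀ m : Finset {ℓ // Zhang2014.IsKolyvaginPrime (W.conductorNorm ℤ) W K p ℓ},
          (∃ v : HeightOneSpectrum (𝓞 K), ((q : ℕ) : 𝓞 K) ∈ v.asIdeal ∧
            κ₀ m (insert q n) ∉ (W.baseChange K).torsionLocalKer (v.adicCompletion K) ((p ^ 1 : ℕ) : ℤ)) ↔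
            lam m n ≠ 0)) →
    (PublishedInputsAdditiveKoly →
    ∀ (W : WeierstrassCurve ℚ) [W.IsElliptic] [W.IsGloballyMinimal] [NeZero (W.conductorNorm ℤ)]
      (p : ℕ) [Fact p.Prime] (K : Type) [Field K] [NumberField K]
      (Dt : ModularParametrizationData W (W.conductorNorm ℤ)) (β : ℤ) (ι : K →+* ℂ),
      5 ≤ p → Addv W p → W.HasSurjectiveModNGaloisRep p →
      (∀ (ℓ : ℕ) [Fact ℓ.Prime], W.HasMultiplicativeReductionAtPrime ℓ →
        ¬ p ∣ padicValInt ℓ W.minimalDiscriminantInt) →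
      (∃ (ℓ₁ ℓ₂ : ℕ) (_ : Fact ℓ₁.Prime) (_ : Fact ℓ₂.Prime), ℓ₁ ≠ ℓ₂ ∧
        W.HasMultiplicativeReductionAtPrime ℓ₁ ∧ W.HasMultiplicativeReductionAtPrime ℓ₂) →
      ¬ p ∣ W.tamagawaProduct → W.analyticRank = 1 →
      IsImaginaryQuadratic K → Odd (NumberField.discr K) → NumberField.discr K < -4 →
      SatisfiesHeegnerHypothesis (W.conductorNorm ℤ) K →
      (W.quadraticTwist (NumberField.discr K : ℚ)).entireLFunction 1 ≠ 0 →
      (4 * (W.conductorNorm ℤ : ℤ)) ∣ β ^ 2 - NumberField.discr K → ¬ (p : ℤ) ∣ Dt.c →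
      ∃ m₀ : Finset {ℓ // Zhang2014.IsKolyvaginPrime (W.conductorNorm ℤ) W K p ℓ},
        ∀ d : KolyvaginHeegnerData Dt β ι (∏ ℓ ∈ m₀, (ℓ : ℕ)), d.kolyvaginClass (Fact.out : p.Prime) 1 ≠ 0) →
    (PublishedInputsAdditiveKoly → PublishedDualityInputsAdditiveKoly →
    ∀ (W : WeierstrassCurve ℚ) [W.IsElliptic] [W.IsGloballyMinimal] [NeZero (W.conductorNorm ℤ)]
      (p : ℕ) [Fact p.Prime] (K : Type) [Field K] [NumberField K]
      (Dt : ModularParametrizationData W (W.conductorNorm ℤ)) (β : ℤ) (ι : K →+* ℂ),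
      5 ≤ p → Addv W p → W.HasSurjectiveModNGaloisRep p →
      (∀ (ℓ : ℕ) [Fact ℓ.Prime], W.HasMultiplicativeReductionAtPrime ℓ →
        ¬ p ∣ padicValInt ℓ W.minimalDiscriminantInt) →
      (∃ (ℓ₁ ℓ₂ : ℕ) (_ : Fact ℓ₁.Prime) (_ : Fact ℓ₂.Prime), ℓ₁ ≠ ℓ₂ ∧
        W.HasMultiplicativeReductionAtPrime ℓ₁ ∧ W.HasMultiplicativeReductionAtPrime ℓ₂) →
      ¬ p ∣ W.tamagawaProduct → W.analyticRank = 1 →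
      IsImaginaryQuadratic K → Odd (NumberField.discr K) → NumberField.discr K < -4 →
      SatisfiesHeegnerHypothesis (W.conductorNorm ℤ) K →
      (W.quadraticTwist (NumberField.discr K : ℚ)).entireLFunction 1 ≠ 0 →
      (4 * (W.conductorNorm ℤ : ℤ)) ∣ β ^ 2 - NumberField.discr K → ¬ (p : ℤ) ∣ Dt.c →
      ∀ (c : K ≃ₐ[ℚ] K), c ≠ 1 → ∀ [Module (ZMod p) (Vp W K p)],
      ∀ (ε₀ : Finset (AdmQ W K p) → Bool)
        (κ₀ : Finset {ℓ // Zhang2014.IsKolyvaginPrime (W.conductorNorm ℤ) W K p ℓ} → Finset (AdmQ W K p) → Vp W K p)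
        (lam : Finset {ℓ // Zhang2014.IsKolyvaginPrime (W.conductorNorm ℤ) W K p ℓ} → Finset (AdmQ W K p) → ZMod p),
        -- realisation at level `∅`: the classes ARE the frame's Kolyvagin classes mod `p`
        (∀ m : Finset {ℓ // Zhang2014.IsKolyvaginPrime (W.conductorNorm ℤ) W K p ℓ},
          ∃ d : KolyvaginHeegnerData Dt β ι (∏ ℓ ∈ m, (ℓ : ℕ)), κ₀ m ∅ = d.kolyvaginClass (Fact.out : p.Prime) 1) →
        -- sign at EVERY even level, `∅` included (Gross Prop. 5.4 (2) at level `∅`; the socket's row is the `n.Nonempty` restriction)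
        (∀ n : Finset (AdmQ W K p), Even n.card →
          ∀ m : Finset {ℓ // Zhang2014.IsKolyvaginPrime (W.conductorNorm ℤ) W K p ℓ},
          conjAct W c ((p ^ 1 : ℕ) : ℤ) (κ₀ m n) = sgnP (ε₀ n ^^ Nat.bodd m.card) • κ₀ m n) →
        -- selmer_off
        (∀ n : Finset (AdmQ W K p), n.Nonempty → Even n.card →
          ∀ (m : Finset {ℓ // Zhang2014.IsKolyvaginPrime (W.conductorNorm ℤ) W K p ℓ}) (v : HeightOneSpectrum (𝓞 K)),
          (∀ ℓ ∈ m, ((ℓ : ℕ) : 𝓞 K) ∉ v.asIdeal) → (∀ q ∈ n, ((q : ℕ) : 𝓞 K) ∉ v.asIdeal) →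
          κ₀ m n ∈ selmerLocalKer (W.baseChange K) (v.adicCompletion K) ((p ^ 1 : ℕ) : ℤ)) →
        -- selmer_inf
        (∀ n : Finset (AdmQ W K p), n.Nonempty → Even n.card →
          ∀ (m : Finset {ℓ // Zhang2014.IsKolyvaginPrime (W.conductorNorm ℤ) W K p ℓ}) (w : InfinitePlace K),
          κ₀ m n ∈ selmerLocalKer (W.baseChange K) w.Completion ((p ^ 1 : ℕ) : ℤ)) →
        -- toric_on
        (∀ n : Finset (AdmQ W K p), n.Nonempty → Even n.card →
          ∀ m : Finset {ℓ // Zhang2014.IsKolyvaginPrime (W.conductorNorm ℤ) W K p ℓ}, ∀ q ∈ n,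
          ∀ v : HeightOneSpectrum (𝓞 K), ((q : ℕ) : 𝓞 K) ∈ v.asIdeal →
          κ₀ m n ∈ toricLocalKer (W.baseChange K) (v.adicCompletion K) ((p ^ 1 : ℕ) : ℤ)) →
        -- transverse_on
        (∀ n : Finset (AdmQ W K p), n.Nonempty → Even n.card →
          ∀ m : Finset {ℓ // Zhang2014.IsKolyvaginPrime (W.conductorNorm ℤ) W K p ℓ}, ∀ ℓ ∈ m,
          ∀ v : HeightOneSpectrum (𝓞 K), ((ℓ : ℕ) : 𝓞 K) ∈ v.asIdeal → κ₀ m n ∈ transverseLocalKerP W K p ι ℓ v) →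
        -- relation (8.1)
        (∀ n : Finset (AdmQ W K p), n.Nonempty → Even n.card →
          ∀ (m : Finset {ℓ // Zhang2014.IsKolyvaginPrime (W.conductorNorm ℤ) W K p ℓ})
            (ℓ : {ℓ // Zhang2014.IsKolyvaginPrime (W.conductorNorm ℤ) W K p ℓ}), ℓ ∉ m →
          ∀ v : HeightOneSpectrum (𝓞 K), ((ℓ : ℕ) : 𝓞 K) ∈ v.asIdeal →
          (κ₀ (insert ℓ m) n ∈ (W.baseChange K).torsionLocalKer (v.adicCompletion K) ((p ^ 1 : ℕ) : ℤ) ↔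
            κ₀ m n ∈ (W.baseChange K).torsionLocalKer (v.adicCompletion K) ((p ^ 1 : ℕ) : ℤ))) →
        -- law (A), TWO-SIDED: the value one level up is a unit iff the class is detected at the NEW prime
        (∀ (n : Finset (AdmQ W K p)) (q : AdmQ W K p), Even n.card → q ∉ n →
          ∀ m : Finset {ℓ // Zhang2014.IsKolyvaginPrime (W.conductorNorm ℤ) W K p ℓ},
          lam m (insert q n) ≠ 0 ↔ ∃ v : HeightOneSpectrum (𝓞 K), ((q : ℕ) : 𝓞 K) ∈ v.asIdeal ∧
            κ₀ m n ∉ (W.baseChange K).torsionLocalKer (v.adicCompletion K) ((p ^ 1 : ℕ) : ℤ)) →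
        -- law (B), TWO-SIDED: the class is detected at a LEVEL prime iff the value one level down is a unit
        (∀ (n : Finset (AdmQ W K p)) (q : AdmQ W K p), Odd n.card → q ∉ n →
          ∀ m : Finset {ℓ // Zhang2014.IsKolyvaginPrime (W.conductorNorm ℤ) W K p ℓ},
          (∃ v : HeightOneSpectrum (𝓞 K), ((q : ℕ) : 𝓞 K) ∈ v.asIdeal ∧
            κ₀ m (insert q n) ∉ (W.baseChange K).torsionLocalKer (v.adicCompletion K) ((p ^ 1 : ℕ) : ℤ)) ↔
            lam m n ≠ 0) →
        -- a non-zero class at level `∅`, ANY Kolyvagin conductor (the ignition, or `c(1) ≠ 0` itself)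
        (∃ m₀ : Finset {ℓ // Zhang2014.IsKolyvaginPrime (W.conductorNorm ℤ) W K p ℓ}, κ₀ m₀ ∅ ≠ 0) →
        ∃ n₀ : Finset (AdmQ W K p), n₀.Nonempty ∧ Even n₀.card ∧
          finrank (ZMod p) (SelQP W K p c n₀ true) + finrank (ZMod p) (SelQP W K p c n₀ false) ≤ 1 ∧
          ∃ m : Finset {ℓ // Zhang2014.IsKolyvaginPrime (W.conductorNorm ℤ) W K p ℓ}, κ₀ m n₀ ≠ 0) →
    (PublishedInputsAdditiveKoly → PublishedDualityInputsAdditiveKoly →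
    ∀ (W : WeierstrassCurve ℚ) [W.IsElliptic] [W.IsGloballyMinimal] [NeZero (W.conductorNorm ℤ)]
      (p : ℕ) [Fact p.Prime] (K : Type) [Field K] [NumberField K]
      (Dt : ModularParametrizationData W (W.conductorNorm ℤ)) (β : ℤ) (ι : K →+* ℂ),
      5 ≤ p → Addv W p → W.HasSurjectiveModNGaloisRep p →
      (∀ (ℓ : ℕ) [Fact ℓ.Prime], W.HasMultiplicativeReductionAtPrime ℓ →
        ¬ p ∣ padicValInt ℓ W.minimalDiscriminantInt) →
      (∃ (ℓ₁ ℓ₂ : ℕ) (_ : Fact ℓ₁.Prime) (_ : Fact ℓ₂.Prime), ℓ₁ ≠ ℓ₂ ∧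
        W.HasMultiplicativeReductionAtPrime ℓ₁ ∧ W.HasMultiplicativeReductionAtPrime ℓ₂) →
      ¬ p ∣ W.tamagawaProduct → W.analyticRank = 1 →
      IsImaginaryQuadratic K → Odd (NumberField.discr K) → NumberField.discr K < -4 →
      SatisfiesHeegnerHypothesis (W.conductorNorm ℤ) K →
      (W.quadraticTwist (NumberField.discr K : ℚ)).entireLFunction 1 ≠ 0 →
      (4 * (W.conductorNorm ℤ : ℤ)) ∣ β ^ 2 - NumberField.discr K → ¬ (p : ℤ) ∣ Dt.c →
      ∀ (c : K ≃ₐ[ℚ] K), c ≠ 1 → ∀ [Module (ZMod p) (Vp W K p)],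
      ∀ (ε₀ : Finset (AdmQ W K p) → Bool)
        (κ₀ : Finset {ℓ // Zhang2014.IsKolyvaginPrime (W.conductorNorm ℤ) W K p ℓ} → Finset (AdmQ W K p) → Vp W K p)
        (lam : Finset {ℓ // Zhang2014.IsKolyvaginPrime (W.conductorNorm ℤ) W K p ℓ} → Finset (AdmQ W K p) → ZMod p),
        -- realisation at level `∅`: the classes ARE the frame's Kolyvagin classes mod `p`
        (∀ m : Finset {ℓ // Zhang2014.IsKolyvaginPrime (W.conductorNorm ℤ) W K p ℓ},
          ∃ d : KolyvaginHeegnerData Dt β ι (∏ ℓ ∈ m, (ℓ : ℕ)), κ₀ m ∅ = d.kolyvaginClass (Fact.out : p.Prime) 1) →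
        -- sign at EVERY even level, `∅` included (Gross Prop. 5.4 (2) at level `∅`; the socket's row is the `n.Nonempty` restriction)
        (∀ n : Finset (AdmQ W K p), Even n.card →
          ∀ m : Finset {ℓ // Zhang2014.IsKolyvaginPrime (W.conductorNorm ℤ) W K p ℓ},
          conjAct W c ((p ^ 1 : ℕ) : ℤ) (κ₀ m n) = sgnP (ε₀ n ^^ Nat.bodd m.card) • κ₀ m n) →
        -- selmer_off
        (∀ n : Finset (AdmQ W K p), n.Nonempty → Even n.card →
          ∀ (m : Finset {ℓ // Zhang2014.IsKolyvaginPrime (W.conductorNorm ℤ) W K p ℓ}) (v : HeightOneSpectrum (𝓞 K)),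
          (∀ ℓ ∈ m, ((ℓ : ℕ) : 𝓞 K) ∉ v.asIdeal) → (∀ q ∈ n, ((q : ℕ) : 𝓞 K) ∉ v.asIdeal) →
          κ₀ m n ∈ selmerLocalKer (W.baseChange K) (v.adicCompletion K) ((p ^ 1 : ℕ) : ℤ)) →
        -- selmer_inf
        (∀ n : Finset (AdmQ W K p), n.Nonempty → Even n.card →
          ∀ (m : Finset {ℓ // Zhang2014.IsKolyvaginPrime (W.conductorNorm ℤ) W K p ℓ}) (w : InfinitePlace K),
          κ₀ m n ∈ selmerLocalKer (W.baseChange K) w.Completion ((p ^ 1 : ℕ) : ℤ)) →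
        -- toric_on
        (∀ n : Finset (AdmQ W K p), n.Nonempty → Even n.card →
          ∀ m : Finset {ℓ // Zhang2014.IsKolyvaginPrime (W.conductorNorm ℤ) W K p ℓ}, ∀ q ∈ n,
          ∀ v : HeightOneSpectrum (𝓞 K), ((q : ℕ) : 𝓞 K) ∈ v.asIdeal →
          κ₀ m n ∈ toricLocalKer (W.baseChange K) (v.adicCompletion K) ((p ^ 1 : ℕ) : ℤ)) →
        -- transverse_on
        (∀ n : Finset (AdmQ W K p), n.Nonempty → Even n.card →
          ∀ m : Finset {ℓ // Zhang2014.IsKolyvaginPrime (W.conductorNorm ℤ) W K p ℓ}, ∀ ℓ ∈ m,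
          ∀ v : HeightOneSpectrum (𝓞 K), ((ℓ : ℕ) : 𝓞 K) ∈ v.asIdeal → κ₀ m n ∈ transverseLocalKerP W K p ι ℓ v) →
        -- relation (8.1)
        (∀ n : Finset (AdmQ W K p), n.Nonempty → Even n.card →
          ∀ (m : Finset {ℓ // Zhang2014.IsKolyvaginPrime (W.conductorNorm ℤ) W K p ℓ})
            (ℓ : {ℓ // Zhang2014.IsKolyvaginPrime (W.conductorNorm ℤ) W K p ℓ}), ℓ ∉ m →
          ∀ v : HeightOneSpectrum (𝓞 K), ((ℓ : ℕ) : 𝓞 K) ∈ v.asIdeal →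
          (κ₀ (insert ℓ m) n ∈ (W.baseChange K).torsionLocalKer (v.adicCompletion K) ((p ^ 1 : ℕ) : ℤ) ↔
            κ₀ m n ∈ (W.baseChange K).torsionLocalKer (v.adicCompletion K) ((p ^ 1 : ℕ) : ℤ))) →
        -- law (A), TWO-SIDED: the value one level up is a unit iff the class is detected at the NEW prime
        (∀ (n : Finset (AdmQ W K p)) (q : AdmQ W K p), Even n.card → q ∉ n →
          ∀ m : Finset {ℓ // Zhang2014.IsKolyvaginPrime (W.conductorNorm ℤ) W K p ℓ},
          lam m (insert q n) ≠ 0 ↔ ∃ v : HeightOneSpectrum (𝓞 K), ((q : ℕ) : 𝓞 K) ∈ v.asIdeal ∧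
            κ₀ m n ∉ (W.baseChange K).torsionLocalKer (v.adicCompletion K) ((p ^ 1 : ℕ) : ℤ)) →
        -- law (B), TWO-SIDED: the class is detected at a LEVEL prime iff the value one level down is a unit
        (∀ (n : Finset (AdmQ W K p)) (q : AdmQ W K p), Odd n.card → q ∉ n →
          ∀ m : Finset {ℓ // Zhang2014.IsKolyvaginPrime (W.conductorNorm ℤ) W K p ℓ},
          (∃ v : HeightOneSpectrum (𝓞 K), ((q : ℕ) : 𝓞 K) ∈ v.asIdeal ∧
            κ₀ m (insert q n) ∉ (W.baseChange K).torsionLocalKer (v.adicCompletion K) ((p ^ 1 : ℕ) : ℤ)) ↔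
            lam m n ≠ 0) →
        ∀ n₀ : Finset (AdmQ W K p), n₀.Nonempty → Even n₀.card →
          finrank (ZMod p) (SelQP W K p c n₀ true) + finrank (ZMod p) (SelQP W K p c n₀ false) ≤ 1 →
          (∃ m : Finset {ℓ // Zhang2014.IsKolyvaginPrime (W.conductorNorm ℤ) W K p ℓ}, κ₀ m n₀ ≠ 0) → κ₀ ∅ n₀ ≠ 0) →
    Summit.BirchSwinnertonDyer.BirchSwinnertonDyer.Theses.AdditiveKolyvaginRoad.LevelKolyvaginSystemsAdditive := by
  intro hPUB hDual hK1 hIgn hClimb hVan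
  refine levelKolyvaginSystemsAdditive_of_seed_free hPUB hDual ?_
  intro W _ _ _ p _ K _ _ Dt β ι h5 hadd hsurj hsp htwo htam hr hK hodd hlt hH hL hβ hcM c hc1 _
  obtain ⟨ε₀, κ₀, lam, hreal, hsign, hoff, hinf, htor, htr, hrel, hA, hB⟩ :=
    hK1 hPUB hDual W p K Dt β ι h5 hadd hsurj hsp htwo htam hr hK hodd hlt hH hL hβ hcM c hc1
  -- the ignition, read through `realisation`: a non-zero class at level `∅`
  obtain ⟨m₀, hm₀⟩ := hIgn hPUB W p K Dt β ι h5 hadd hsurj hsp htwo htam hr hK hodd hlt hH hL hβ hcM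
  have hseed₀ : ∃ m₀ : Finset {ℓ // Zhang2014.IsKolyvaginPrime (W.conductorNorm ℤ) W K p ℓ}, κ₀ m₀ ∅ ≠ 0 := by
    refine ⟨m₀, fun h0 ↦ ?_⟩
    obtain ⟨d, hd⟩ := hreal m₀
    exact hm₀ d (by rw [← hd, h0])
  -- climb to a non-empty even level of total canonical rank ≤ 1 with a non-zero class
  obtain ⟨n₀, hne, hev, hcore, hmn⟩ :=
    hClimb hPUB hDual W p K Dt β ι h5 hadd hsurj hsp htwo htam hr hK hodd hlt hH hL hβ hcM c hc1 ε₀ κ₀ lam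
      hreal hsign hoff hinf htor htr hrel hA hB hseed₀
  -- vanishing order zero there: the conductor-one class is the seed
  have hseed : κ₀ ∅ n₀ ≠ 0 :=
    hVan hPUB hDual W p K Dt β ι h5 hadd hsurj hsp htwo htam hr hK hodd hlt hH hL hβ hcM c hc1 ε₀ κ₀ lam
      hreal hsign hoff hinf htor htr hrel hA hB n₀ hne hev hcore hmn
  exact ⟨ε₀, κ₀, lam, n₀, hreal, fun n _ hn m ↦ hsign n hn m, hoff, hinf, htor, htr, hrel, hA, hB, hcore,
    Or.inl ⟨hev, hseed⟩⟩

/-- The crux OUTRIGHT from the (sorried) stubs — what closes when the six stubs close. -/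
theorem levelKolyvaginSystemsAdditive_closed_of_stubs :
    Summit.BirchSwinnertonDyer.BirchSwinnertonDyer.Theses.AdditiveKolyvaginRoad.LevelKolyvaginSystemsAdditive :=
  LevelKolyvaginSystemsAdditive_of stub_publishedInputs stub_publishedDualityInputs stub_geometricBipartiteDatum
    stub_additiveFibreIgnition stub_levelClimbOfIgnition stub_kolyvaginRankOneVanishing

/-- ROUTE-LEVEL READING (kernel-checked; closes nothing — it rests on the `sorry`s of PUB and IGNITION only): the stubs PUB and
IGNITION ALONE give the route's crux r2 `KolyvaginPrimitiveAdditive` (KPA′, item stmt-BirchSwinnertonDyer-21400) BY NAME — no K1,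
no climb, no vanishing lemma, no KS′: a Kolyvagin–Heegner datum of conductor `∏ m₀` exists unconditionally
(`nonempty_kolyvaginHeegnerData_finsetProd`, p566745), `∏ m₀` is a square-free product of Kolyvagin primes
(`Method2.kolSupp_finsetProd`), and the seed says its class is non-zero. This is TRIAGE-r1-2 §2-C's «21400-line in a 21396 coat»
as a theorem: once an engine fires the seed, the route's `closes` can be fed at r2 directly. BSD is not proved by this. -/
theorem kolyvaginPrimitiveAdditive_of_stubs :
    Summit.BirchSwinnertonDyer.BirchSwinnertonDyer.Theses.AdditiveKolyvaginRoad.KolyvaginPrimitiveAdditive := by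
  intro W _ _ _ p _ K _ _ Dt β ι h5 hadd hsurj hsp htwo htam hr hK hodd hlt hH hL hβ hcM
  obtain ⟨m₀, hm₀⟩ :=
    stub_additiveFibreIgnition stub_publishedInputs W p K Dt β ι h5 hadd hsurj hsp htwo htam hr hK hodd hlt hH hL hβ hcM
  obtain ⟨d⟩ := nonempty_kolyvaginHeegnerData_finsetProd W K p hK hH Dt β ι hβ m₀
  exact ⟨_, d, Method2.kolSupp_finsetProd (fun ℓ h ↦ h.1) m₀, hm₀ d⟩

end Summit.BirchSwinnertonDyer.BirchSwinnertonDyer.Cruxes.LevelKolyvaginSystemsAdditive.AdditiveFibreIgnition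

end
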